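import Mathlib
import Summits.Parity.BatemanHorn.Theses.IsogenyRedei
import Literature.NumberTheory.EllipticCurves.BSDRootNumber
import Literature.NumberTheory.EllipticCurves.Selmer

/-!
# Sketch — crux-ideate stmt-Parity-14950 (PencilSelmerParitySW), ideator 1, round 1

First lemmas of the idea card `epsilon-detector-kuznetsov`: the parity bit of the pencil member
`E_t = ⟨0, 2t, 0, t²+1, 0⟩` is, by modularity + the functional equation, the EXACT vanishing of a
Type-I-length Dirichlet polynomial in the coefficients `a_n(E_t)`, `n ≲ √N_t ≍ t` (the
"ε-detectors"); the family (first-moment) side over `t ≤ x` in an AP reduces by Poisson summation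
mod `n` to Gauss-sign–twisted Kloosterman sums (lemma `pencilTrace_fourier`, verified numerically
for p ≤ 29), whose sums over the modulus `n ≍ x` have BETTER than square-root cancellation
(Kuznetsov / Blomer–Milićević, Kloosterman sums in residue classes).
Nothing here is proved; every `def … : Prop` is a statement, the two `theorem`s are stubs.
-/

namespace Summit.Parity.BatemanHorn.Cruxes.PencilSelmerParitySW.EpsilonDetector

open scoped BigOperators
open Complex

/-- The pencil `E_t : y² = x³ + 2t x² + (t²+1) x = x((x+t)²+1)` of the crux. -/
def pencil (t : ℕ) : WeierstrassCurve ℚ := ⟨0, 2 * (t : ℚ), 0, (t : ℚ) ^ 2 + 1, 0⟩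

/-- Mellin weight of the odd-detector on the line `Re u = 1` with the even kernel `G(u) = exp(u²)`:
`W(y) = ∫_ℝ y^{-(1+iv)} Γ(2+iv) exp((1+iv)²) dv`; `W(y) ≪_A y^{-A}` as `y → ∞` and `W(y) ≪ y^{1-δ}`
as `y → 0` (band-pass around `y ≍ 1`). -/
noncomputable def detectorWeight (y : ℝ) : ℂ :=
  ∫ v : ℝ, ((y : ℂ) ^ (-(1 + (v : ℂ) * I))) * Complex.Gamma (2 + (v : ℂ) * I) *
    Complex.exp ((1 + (v : ℂ) * I) ^ 2)

/-- The odd-detector `F(W; N) = Σ_{n ≥ 1} a_n(W) n⁻¹ · W(2π n / √N)`: a Dirichlet polynomial of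
effective length `√N · N^{ε}` in the coefficients of Mathlib's `WeierstrassCurve.LFunction`. -/
noncomputable def oddDetector (W : WeierstrassCurve ℚ) (N : ℕ) : ℂ :=
  ∑' n : ℕ, ((W.LFunction n : ℤ) : ℂ) / (n : ℂ) *
    detectorWeight (2 * Real.pi * (n : ℝ) / Real.sqrt (N : ℝ))

/-- **First lemma L1 (ε-detector identity).** If the pencil member has root number `−1`, its
odd-detector vanishes: `(√N/2π)·F = (1/2π)∫_{Re u = 1} Λ(1+u) e^{u²} du` (termwise Mellin, absolute
convergence at `Re s = 2`) `= (1/2π)∫_{Re u = 0} Λ(1+u)e^{u²}du` (Λ entire of finite order, Gaussian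
decay of the kernel) and the last integrand is odd in `u ↔ −u` when `Λ(1−u) = −Λ(1+u)`.
Hypothesis: the bsd.S08 named fact (modularity ⇒ functional equation with sign `W.rootNumber`). -/
def OddDetectorVanishes : Prop :=
  ∀ t : ℕ, 1 ≤ t →
    Literature.NumberTheory.EllipticCurves.completedLFunction_functional_equation (pencil t) →
    (pencil t).rootNumber = -1 →
    oddDetector (pencil t) ((pencil t).conductorNorm ℤ) = 0

/-- L1, contour half (the trivial half, recorded to fix conventions): on the central line the
Gaussian average of an odd completed L-function is zero. -/
def OddDetectorContour : Prop :=
  ∀ t : ℕ, 1 ≤ t →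
    Literature.NumberTheory.EllipticCurves.completedLFunction_functional_equation (pencil t) →
    (pencil t).rootNumber = -1 →
    (∫ v : ℝ, (pencil t).completedLContinuation ((pencil t).conductorNorm ℤ) (1 + (v : ℂ) * I) *
        Complex.exp (((v : ℂ) * I) ^ 2)) = 0

/-- **L2 (dictionary to the crux's currency).** On the pencil the analytic sign IS the Selmer
parity sign: `w(E_t) = (−1)^{corank_{ℤ₂} Sel_{2^∞}(E_t/ℚ)}` (2-parity: Dokchitser–Dokchitser 2010
Thm 1.4 / Monsky; tree: `selmerCorank_mod_two_eq` + `even_analyticRank_iff_rootNumber_eq_one`). So the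
crux `PencilSelmerParitySW` is literally root-number equidistribution of the pencil in APs with a
Siegel–Walfisz rate, and `OddDetectorVanishes` detects the summand `−1`. -/
def RootNumberSelmer : Prop :=
  ∀ t : ℕ, 1 ≤ t →
    ((pencil t).rootNumber : ℝ) = (-1 : ℝ) ^ WeierstrassCurve.selmerCorank (pencil t) 2

/-- The crux in root-number currency (equivalent to `PencilSelmerParitySW` under `RootNumberSelmer`). -/
def RootNumberSW : Prop :=
  ∀ A : ℝ, 0 < A → ∃ C : ℝ, ∃ x₀ : ℕ, ∀ x : ℕ, x₀ ≤ x → ∀ q : ℕ, 1 ≤ q → (q : ℝ) ≤ Real.log x ^ A →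
    ∀ a : ℕ, |∑ t ∈ (Finset.Icc 1 x).filter (fun t : ℕ => t ≡ a [MOD q]),
      ((pencil t).rootNumber : ℝ)| ≤ C * (x : ℝ) / Real.log x ^ A

theorem rootNumberSW_iff (h : RootNumberSelmer) :
    RootNumberSW ↔ Summit.Parity.BatemanHorn.Theses.IsogenyRedei.PencilSelmerParitySW := by
  sorry

/-- **L3 (Poisson side; finite fields, provable now).** The Frobenius trace of the fibre `E_t/𝔽_p`
as a character sum: `a_t(p) = −Σ_x ((x³ + 2t x² + (t²+1) x)/p)`. -/
def pencilTrace (p : ℕ) [Fact p.Prime] (t : ZMod p) : ℤ :=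
  -∑ x : ZMod p, legendreSym p ((((x ^ 3 + 2 * t * x ^ 2 + (t ^ 2 + 1) * x : ZMod p)).val : ℕ) : ℤ)

/-- L3a: the complete family sum vanishes, `Σ_{t mod p} a_t(p) = 0` (shift `t ↦ t − x`, Jacobsthal
`Σ_s ((s²+1)/p) = −1`, then `Σ_x (x/p) = 0`). Consequence: the zero frequency of the Poisson dual
carries no main term on squarefree moduli. Verified numerically for p ≤ 29 (check_kloosterman.py). -/
theorem pencilTrace_sum (p : ℕ) [Fact p.Prime] (hp : p ≠ 2) :
    ∑ t : ZMod p, pencilTrace p t = 0 := by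
  sorry

/-- Kloosterman sum `Kl(a, b; p) = Σ_{y ∈ 𝔽_pˣ} e((a y + b y⁻¹)/p)`. -/
noncomputable def kloosterman (p : ℕ) [NeZero p] (a b : ZMod p) : ℂ :=
  ∑ y : (ZMod p)ˣ, ZMod.stdAddChar (N := p) (a * (y : ZMod p) + b * ((y⁻¹ : (ZMod p)ˣ) : ZMod p))

/-- L3b: the Fourier transform of `t ↦ a_t(p)` is a Gauss-sign–twisted KLOOSTERMAN sum:
`Σ_{t mod p} a_t(p) e(ht/p) = −((−h)/p) · τ_p · Kl(1, −h²/4; p)` for `h ≢ 0`, `τ_p = Σ_x (x/p)e(x/p)`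
(substitute `t ↦ t − x`; Gauss inversion of `((s²+1)/p)`; quadratic Gauss sum in `s`). Verified
numerically to machine precision for p ∈ {5,7,11,13,17,29}, all h. This is what makes the family
first moment of the ε-detectors a sum of Kloosterman sums OVER THE MODULUS. -/
theorem pencilTrace_fourier (p : ℕ) [Fact p.Prime] (hp : p ≠ 2) (h : ZMod p) (hh : h ≠ 0) :
    ∑ t : ZMod p, (pencilTrace p t : ℂ) * ZMod.stdAddChar (N := p) (h * t) =
      -(((quadraticChar (ZMod p) (-h) : ℤ) : ℂ) *
        gaussSum ((quadraticChar (ZMod p)).ringHomComp (Int.castRingHom ℂ))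
          (ZMod.stdAddChar (N := p)) *
        kloosterman p 1 (-(h ^ 2) * (4 : ZMod p)⁻¹)) := by
  sorry

/-- **Target T1 of the line (theorem-candidate, NOT the crux):** the first moment of the
odd-detector over the squarefree part of the pencil in any AP has a POWER saving — no main term
(zero frequency killed by `pencilTrace_sum` off squarefull moduli; dual frequencies = sums of
Kloosterman sums over moduli `n ≍ x` in residue classes, Kuznetsov/Blomer–Milićević, θ ≤ 7/64 < 1/4). -/
def FirstMomentOddDetector : Prop :=
  ∃ δ : ℝ, 0 < δ ∧ ∀ q a : ℕ, 1 ≤ q → ∃ C : ℝ, ∀ x : ℕ, 2 ≤ x →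
    ‖∑ t ∈ (Finset.Icc 1 x).filter (fun t : ℕ => t ≡ a [MOD q] ∧ Squarefree (t ^ 2 + 1)),
        oddDetector (pencil t) ((pencil t).conductorNorm ℤ)‖ ≤ C * (x : ℝ) ^ (1 - δ)

end Summit.Parity.BatemanHorn.Cruxes.PencilSelmerParitySW.EpsilonDetector
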